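import Summits.BirchSwinnertonDyer.BirchSwinnertonDyer.Theorems.KolyvaginDepthDoorDepthTableLambdaJoin
import Summits.BirchSwinnertonDyer.BirchSwinnertonDyer.Theorems.Rank2ObservatoryPadicAtlasR2A00
import Summits.BirchSwinnertonDyer.BirchSwinnertonDyer.Theorems.Rank2ObservatoryPadicAtlasR2A01
import Summits.BirchSwinnertonDyer.BirchSwinnertonDyer.Theorems.Rank2ObservatoryPadicRowCells
import Summits.BirchSwinnertonDyer.BirchSwinnertonDyer.Theorems.Rank2Observatory389a1RankTwo
import Summits.BirchSwinnertonDyer.BirchSwinnertonDyer.Theorems.KolyvaginDepthDoorDepthTableRows1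
import Summits.BirchSwinnertonDyer.BirchSwinnertonDyer.Theorems.KolyvaginDepthDoorDepthTableRows2
import Summits.BirchSwinnertonDyer.BirchSwinnertonDyer.Theorems.KolyvaginDepthDoorDepthTableRows4
import Summits.BirchSwinnertonDyer.BirchSwinnertonDyer.Theorems.KolyvaginDepthDoorDepthTableRows5
import Summits.BirchSwinnertonDyer.BirchSwinnertonDyer.Theorems.KolyvaginDepthDoorDepthTableAdditiveSurjectivityA
import Summits.BirchSwinnertonDyer.BirchSwinnertonDyer.Theorems.KolyvaginDepthDoorDepthTableAdditiveSurjectivityB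
import HarnessLib

/-!
# Route `KolyvaginDepthDoor` — the λ-join AT THE 18 DEPTH-TABLE CURVES: the crux's clause at each curve
# from its `p`-adic atlas cell, with `ρ̄` onto and `2 ≤ rank` discharged in the kernel
# (crux `KolyvaginDepthSupply`, stmt-BirchSwinnertonDyer-21765)

Helper file (`--supports stmt-BirchSwinnertonDyer-21765 --as helper`); it closes nothing and BSD is
not proved by it. HONEST FRAMING: per-curve theorems, CONDITIONAL on seven named literature facts
(`hA` BCGS 2026 Thm. 1, `hF` Kolyvagin 1991 Thm. 4, `hmod` modularity, `hHL` Hoffstein–Luo 1997,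
`hBFH` Bump–Friedberg–Hoffstein 1990, `hGZK` Gross–Zagier–Kolyvagin, `hPRS` Perrin-Riou–Schneider),
on Kato 17.4 for the curve's newform (`hkato`, a binder of the atlas) and on the atlas's modular-symbol
DATA hypotheses (`D, hD, hint, htab`); the crux stays OPEN (class-wide = X1 on non-CM curves at a
surjective prime, g0's `kolyvaginDepthSupply_iff_shaCorankZeroSurj_nonCM`).

This is the instantiation of `KolyvaginDepthDoorDepthTableLambdaJoin` (`kolyvaginDepthSupply_clause_of_atlasCell`)
at the route's DEPTH TABLE — the 18 Cremona rank-2 curves `N ≤ 1000` — which are all curves of the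
tree's `p`-adic atlas (`Rank2ObservatoryPadicAtlasR2A00`: `389a1 … 794a1`; `…R2A01`: `817a1 … 997c1`),
with cells at `p = 5` for 17 of them and at `p = 7` for `655a1` (`5 ∣ 655`):

* `depthTable_atlas_ok` — the 18 atlas curves pass the kernel tests (`check ∧ minCheck`, assembled
  from the atlas's per-curve `decide` certificates): elliptic, globally minimal, every cell good
  ordinary with a valid Riemann-sum certificate.
* `two_le_rank_of_mem_depthTable` — `2 ≤ rank_ℤ E(ℚ)` for the 18 census rows (the tree's kernel
  certificates `Curve389a1.two_le_mordellWeilRank_row`, `KernelCerts00{1,2,3}/R01.C<label>.row`).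
* `hasSurjectiveModNGaloisRep_five_of_mem_depthTable` — `ρ̄_{E,5}` onto for the 17 curves with a
  `p = 5` cell, and `hasSurjectiveModNGaloisRep_seven_655a1` — transported VERBATIM from g2's depth-table
  rows (`C<label>.hasSurjectiveModNGaloisRep_5/7`: Mazur Frobenius witness + Serre Prop. 21 / Prop. 19),
  the atlas's integer model being definitionally g2's `[a₁,…,a₆]`.
* `kolyvaginDepthSupply_clause_of_lambda_of_mem_depthTable` — **every cell** (`p ∈ {5, 7, 11, 13}`)
  of every depth-table curve: `ρ̄_{E,p}` onto (hypothesis at `p ≠ 5`) + the atlas binders ⟹ the clause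
  of `KolyvaginDepthSupply` at `C.e ⊗ ℚ`, verbatim.
* `kolyvaginDepthSupply_clause_of_lambda_five_of_mem_depthTable` /
  `exists_kolyvaginPrime_class_ne_zero_of_lambda_five_of_mem_depthTable` — **the 17 rows at `p = 5`
  with NO surjectivity hypothesis left**: atlas binders ⟹ the clause, resp. a Kolyvagin PRIME `ℓ` with
  `c_M(ℓ) ≠ 0` and no non-zero class at depth `0` — the depth table's bit PREDICTED from the
  cyclotomic side; `…_seven_655a1` the 18th row at `p = 7`.
* `C389a1.kolyvaginDepthSupply_clause_of_lambda` — the showcase in the wording of g2's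
  `C389a1.kolyvaginDepthSupply_clause` (`W = Curve389a1.E`).

AGREEMENT READING (the route header's instrument «depth vs λ-door agreement»): at each of the 18
curves the crux's clause now has TWO certificates in the tree — g2's `C<label>.kolyvaginDepthSupply_clause`
(anticyclotomic: Kolyvagin Thm. 4 + the COMPUTED bit `c_1(ℓ) ≠ 0` at a named `(p, d_K, ℓ)`) and this
file's λ-row (cyclotomic: seven print facts + Kato 17.4 + one kernel-checked modular-symbol table, NO
derived-class computation) — sharing only Kolyvagin Thm. 4. Neither is a class theorem; BSD is not
proved by any of this.

References: [SteinWuthrich2013] Thm. 1.1, §3; [MazurTateTeitelbaum1986Invent] §I.10–I.13;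
[Kato2004Asterisque] Thm. 17.4; [BalakrishnanMullerStein2015] Thm. 1.7; [BurungaleEtAl2026]
arXiv:2312.09301 Thm. 1; [Kolyvagin1991MathAnn] §2 Thm. 4; [CremonaAlgorithms1997] Table 1;
[Serre1972] §5.4 Prop. 21, Prop. 19; [JetchevLauterStein2009] arXiv:0707.0032 §3.6.
-/

set_option linter.dupNamespace false

noncomputable section

open scoped Classical

namespace Summit.BirchSwinnertonDyer.BirchSwinnertonDyer.Theorems.KolyvaginDepthDoor

open Literature.NumberTheory.EllipticCurves Literature.NumberTheory.EllipticCurves.ModularForms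
  WeierstrassCurve CongruenceSubgroup
open Summit.BirchSwinnertonDyer.BirchSwinnertonDyer.Theorems
open Summit.BirchSwinnertonDyer.BirchSwinnertonDyer.Rank2Observatory

/-! ## §1 The 18 depth-table curves in the atlas: kernel tests, rank certificates, surjectivity -/

/-- **The 18 depth-table curves pass the atlas's kernel tests** (`check`: `Δ ≠ 0` and every cell
checks; `minCheck`: the finite global-minimality criterion) — assembled from the atlas's per-curve
`decide` certificates `c<label>_ok`. [cite: CremonaAlgorithms1997, Table 1] -/
theorem depthTable_atlas_ok :
    ([c389a1, c433a1, c446d1, c563a1, c571b1, c643a1, c655a1, c664a1, c681c1, c707a1, c709a1,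
      c718b1, c794a1, c817a1, c916c1, c944e1, c997b1, c997c1] : List AtlasCurve).all (fun C => C.check && C.minCheck) = true := by
  simp only [List.all_cons, List.all_nil, Bool.and_true, c389a1_ok, c433a1_ok, c446d1_ok, c563a1_ok,
    c571b1_ok, c643a1_ok, c655a1_ok, c664a1_ok, c681c1_ok, c707a1_ok, c709a1_ok, c718b1_ok, c794a1_ok,
    c817a1_ok, c916c1_ok, c944e1_ok, c997b1_ok, c997c1_ok]

/-- **`2 ≤ rank_ℤ E(ℚ)` for the 18 depth-table census rows** — the tree's kernel certificates (two
listed generators, independence mod torsion by doubling witnesses; `Rank2ObservatoryKernelCerts*`).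
[cite: CremonaAlgorithms1997, Table 1, §3.5] [cite: SilvermanAEC2009, Thm. VIII.6.7] -/
theorem two_le_rank_of_mem_depthTable :
    ∀ C ∈ ([c389a1, c433a1, c446d1, c563a1, c571b1, c643a1, c655a1, c664a1, c681c1, c707a1, c709a1,
      c718b1, c794a1, c817a1, c916c1, c944e1, c997b1, c997c1] : List AtlasCurve), 2 ≤ C.row.curve.mordellWeilRank := by
  simp only [List.forall_mem_cons]
  exact ⟨Curve389a1.two_le_mordellWeilRank_row, KernelCerts001.C433a1.row,
    KernelCerts001.C446d1.row, KernelCerts001.C563a1.row, KernelCerts001.C571b1.row,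
    KernelCerts001.C643a1.row, KernelCerts001.C655a1.row, KernelCerts001.C664a1.row,
    KernelCerts002.C681c1.row, KernelCerts002.C707a1.row, KernelCerts002.C709a1.row,
    KernelCerts002.C718b1.row, KernelCerts002.C794a1.row, KernelCertsR01.C817a1.row,
    KernelCerts002.C916c1.row, KernelCerts002.C944e1.row, KernelCertsR01.C997b1.row,
    KernelCerts003.C997c1.row, by simp⟩

/-- **`ρ̄_{E,5}` is surjective for the 17 depth-table curves with a `p = 5` cell** — g2's kernel
theorems `C<label>.hasSurjectiveModNGaloisRep_5` (semistable curves: Mazur's Frobenius no-root witness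
⇒ `E[5]` irreducible, Serre 1972 Prop. 21 ⇒ onto; the three curves additive at `2`: Serre Prop. 19
from three Frobenius traces), read on the atlas's integer model (definitionally g2's `[a₁,…,a₆]`;
for `389a1` via `Cell389a1.baseChange_e389_eq`). [cite: Serre1972, §5.4 Prop. 21 and Prop. 19]
[cite: Mazur1978, §6 Prop. 6.3 (1)] -/
theorem hasSurjectiveModNGaloisRep_five_of_mem_depthTable :
    ∀ C ∈ ([c389a1, c433a1, c446d1, c563a1, c571b1, c643a1, c664a1, c681c1, c707a1, c709a1, c718b1,
      c794a1, c817a1, c916c1, c944e1, c997b1, c997c1] : List AtlasCurve), (C.e.baseChange ℚ).HasSurjectiveModNGaloisRep (5 : ℕ) := by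
  simp only [List.forall_mem_cons]
  refine ⟨?_, C433a1.hasSurjectiveModNGaloisRep_5, C446d1.hasSurjectiveModNGaloisRep_5,
    C563a1.hasSurjectiveModNGaloisRep_5, C571b1.hasSurjectiveModNGaloisRep_5,
    C643a1.hasSurjectiveModNGaloisRep_5, C664a1.hasSurjectiveModNGaloisRep_5,
    C681c1.hasSurjectiveModNGaloisRep_5, C707a1.hasSurjectiveModNGaloisRep_5,
    C709a1.hasSurjectiveModNGaloisRep_5, C718b1.hasSurjectiveModNGaloisRep_5,
    C794a1.hasSurjectiveModNGaloisRep_5, C817a1.hasSurjectiveModNGaloisRep_5,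
    C916c1.hasSurjectiveModNGaloisRep_5, C944e1.hasSurjectiveModNGaloisRep_5,
    C997b1.hasSurjectiveModNGaloisRep_5, C997c1.hasSurjectiveModNGaloisRep_5, by simp⟩
  rw [show c389a1.e.baseChange ℚ = Curve389a1.E from Cell389a1.baseChange_e389_eq]
  exact C389a1.hasSurjectiveModNGaloisRep_5

/-- **`ρ̄_{E,7}` is surjective for `655a1`** (the 18th curve; `5 ∣ 655`, its atlas cells are at
`p = 7, 11, 13`) — g2's `C655a1.hasSurjectiveModNGaloisRep_7` on the atlas's integer model.
[cite: Serre1972, §5.4 Prop. 21] [cite: Mazur1978, §6 Prop. 6.3 (1)] -/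
theorem hasSurjectiveModNGaloisRep_seven_655a1 :
    (c655a1.e.baseChange ℚ).HasSurjectiveModNGaloisRep (7 : ℕ) :=
  C655a1.hasSurjectiveModNGaloisRep_7


/-- The 17 curves with a `p = 5` cell are among the 18 depth-table curves. [folklore] -/
theorem mem_depthTable_of_mem_five {C : AtlasCurve} (hC : C ∈ ([c389a1, c433a1, c446d1, c563a1, c571b1, c643a1, c664a1, c681c1, c707a1, c709a1, c718b1,
      c794a1, c817a1, c916c1, c944e1, c997b1, c997c1] : List AtlasCurve)) :
    C ∈ ([c389a1, c433a1, c446d1, c563a1, c571b1, c643a1, c655a1, c664a1, c681c1, c707a1, c709a1,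
      c718b1, c794a1, c817a1, c916c1, c944e1, c997b1, c997c1] : List AtlasCurve) := by
  simp only [List.mem_cons, List.mem_nil_iff, or_false] at hC ⊢
  rcases hC with h | h | h | h | h | h | h | h | h | h | h | h | h | h | h | h | h <;> simp [h]

/-! ## §2 Every atlas cell of a depth-table curve: surjectivity + the λ-row give the clause -/

/-- **The λ-join at the depth table, all cells** (`p = c.p ∈ {5, 7, 11, 13}` good ordinary). For a
depth-table curve `C` (one of the 18) and a cell `c ∈ C.cells`: `ρ̄_{E,p}` onto (a HYPOTHESIS here —
discharged at `p = 5` in §3), the newform `hf`, Kato 17.4 `hkato`, and the symbol DATA `D, hD, hint,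
htab` give the clause of `KolyvaginDepthSupply` at `W = C.e ⊗ ℚ`, verbatim
(`kolyvaginDepthSupply_clause_of_atlasCell` with `check`, `2 ≤ rank` discharged by §1). CONDITIONAL on
the seven named facts, `hkato` and the symbol data; per-curve; BSD is not proved by it.
[cite: SteinWuthrich2013, Thm. 1.1 and §3] [cite: BurungaleEtAl2026, Thm. 1 (arXiv:2312.09301 §0.1)]
[cite: Kolyvagin1991MathAnn, §2 Thm. 4] -/
theorem kolyvaginDepthSupply_clause_of_lambda_of_mem_depthTable
    (hA : BurungaleEtAl2026_exists_kolyvaginClass_ne_zero)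
    (hF : Kolyvagin1991_selmerCorank_of_kolyvaginClass_ne_zero)
    (hmod : exists_isNewformOf) (hHL : HoffsteinLuo1997_exists_twist_L_one_ne_zero)
    (hBFH : bumpFriedbergHoffstein_exists_heegnerField_split_twist_simpleZero)
    (hGZK : rank_eq_analyticRank_of_analyticRank_le_one) (hPRS : Schneider1985_order_charGenerator) :
    ∀ (C : AtlasCurve) (hC : C ∈ ([c389a1, c433a1, c446d1, c563a1, c571b1, c643a1, c655a1, c664a1, c681c1, c707a1, c709a1,
      c718b1, c794a1, c817a1, c916c1, c944e1, c997b1, c997c1] : List AtlasCurve)) (c : AtlasCell) (_ : c ∈ C.cells)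
    [Fact c.p.Prime],
    haveI := AtlasCurve.isElliptic (AtlasCurve.check_of_all depthTable_atlas_ok hC).1;
    haveI := AtlasCurve.isGloballyMinimal (AtlasCurve.check_of_all depthTable_atlas_ok hC).2;
    (C.e.baseChange ℚ).HasSurjectiveModNGaloisRep c.p →
    ∀ {N : ℕ} [NeZero N] {f : CuspForm (Gamma0 N) 2}, IsNewformOf (C.e.baseChange ℚ) f →
      (∀ (κ : ZpExtension ℚ c.p) (γ : Field.absoluteGaloisGroup ℚ),
        kato_divisibility (C.e.baseChange ℚ) c.p (κ := κ) (γ := γ) (f := f)) →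
      ∀ (D : ℚ), ‖(D : ℚ_[c.p])‖ = 1 → (∀ x : ℚ, ‖(ratPlusSymbol f x : ℚ_[c.p])‖ ≤ 1) →
      (∀ u : ℕ, u < c.p ^ (c.n + 1) → ¬ c.p ∣ u →
        ratPlusSymbol f ((u : ℚ) / (c.p : ℚ) ^ (c.n + 1)) = (c.tabHi.getD u 0 : ℚ) / D ∧
        ratPlusSymbol f ((u : ℚ) / (c.p : ℚ) ^ c.n) = (c.tabLo.getD (u % c.p ^ c.n) 0 : ℚ) / D) →
      ∃ (p : ℕ) (hp : Fact p.Prime), 5 ≤ p ∧ (C.e.baseChange ℚ).HasGoodReductionAtPrime p ∧ ¬ (p : ℤ) ∣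
      (C.e.baseChange ℚ).frobeniusTrace p ∧ (C.e.baseChange ℚ).HasSurjectiveModNGaloisRep p ∧ ∃ (K : Type) (_ : Field K) (_ :
      NumberField K), Literature.NumberTheory.EllipticCurves.IsImaginaryQuadratic K ∧
      NumberField.discr K ≠ -3 ∧ NumberField.discr K ≠ -4 ∧ ¬ ((p : ℤ) ∣ NumberField.discr K) ∧ ¬ (p
      ∣ (C.e.baseChange ℚ).conductorNorm ℤ) ∧ ∃ (_ : NeZero ((C.e.baseChange ℚ).conductorNorm ℤ)),
      Literature.NumberTheory.EllipticCurves.SatisfiesHeegnerHypothesis ((C.e.baseChange ℚ).conductorNorm ℤ) K ∧ ∃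
      (Dt : Literature.NumberTheory.EllipticCurves.ModularForms.ModularParametrizationData (C.e.baseChange ℚ)
      ((C.e.baseChange ℚ).conductorNorm ℤ)) (β : ℤ) (ι : K →+* ℂ) (n : ℕ) (d :
      Literature.NumberTheory.EllipticCurves.KolyvaginHeegnerData Dt β ι n) (M : ℕ),
      Literature.NumberTheory.EllipticCurves.KolyvaginDescent.KolSupp
      (Literature.NumberTheory.EllipticCurves.Zhang2014.IsKolyvaginPrime ((C.e.baseChange ℚ).conductorNorm ℤ) (C.e.baseChange ℚ) K p)
      n ∧ 1 ≤ M ∧ (M : ℕ∞) ≤ Literature.NumberTheory.EllipticCurves.Zhang2014.levelIndex (C.e.baseChange ℚ) p n ∧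
      d.kolyvaginClass hp.out M ≠ 0 ∧ (∀ (n' : ℕ) (d' :
      Literature.NumberTheory.EllipticCurves.KolyvaginHeegnerData Dt β ι n') (M' : ℕ),
      Literature.NumberTheory.EllipticCurves.KolyvaginDescent.KolSupp
      (Literature.NumberTheory.EllipticCurves.Zhang2014.IsKolyvaginPrime ((C.e.baseChange ℚ).conductorNorm ℤ) (C.e.baseChange ℚ) K p)
      n' → 1 ≤ M' → (M' : ℕ∞) ≤ Literature.NumberTheory.EllipticCurves.Zhang2014.levelIndex (C.e.baseChange ℚ) p n' →
      d'.kolyvaginClass hp.out M' ≠ 0 → n.primeFactors.card ≤ n'.primeFactors.card) ∧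
      ((n.primeFactors.card + 1 = (C.e.baseChange ℚ).mordellWeilRank ∧ ((C.e.baseChange ℚ).quadraticTwist (NumberField.discr K :
      ℚ)).mordellWeilRank < (C.e.baseChange ℚ).mordellWeilRank) ∨ (n.primeFactors.card = (C.e.baseChange ℚ).mordellWeilRank ∧
      ((C.e.baseChange ℚ).quadraticTwist (NumberField.discr K : ℚ)).mordellWeilRank = (C.e.baseChange ℚ).mordellWeilRank + 1)) := by
  intro C hC c hc _ hsurj N _ f hf hkato D hD hint htab
  haveI := AtlasCurve.isElliptic (AtlasCurve.check_of_all depthTable_atlas_ok hC).1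
  haveI := AtlasCurve.isGloballyMinimal (AtlasCurve.check_of_all depthTable_atlas_ok hC).2
  exact kolyvaginDepthSupply_clause_of_atlasCell hA hF hmod hHL hBFH hGZK hPRS
    (AtlasCurve.check_of_all depthTable_atlas_ok hC).1 hc _ rfl hf hkato
    (two_le_rank_of_mem_depthTable C hC) D hD hint htab hsurj

/-! ## §3 The 17 rows at `p = 5` and the row `655a1` at `p = 7`: no surjectivity hypothesis left -/

/-- **AGREEMENT ROWS, λ-side, `p = 5` (17 curves).** For a depth-table curve `C` other than `655a1`
and its cell `c` with `c.p = 5`: the newform `hf`, Kato 17.4 `hkato` and the symbol DATA give the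
clause of `KolyvaginDepthSupply` at `W = C.e ⊗ ℚ`, verbatim — `ρ̄_{E,5}` onto, `2 ≤ rank`, global
minimality, good ordinary reduction at `5` and the Riemann-sum certificate `ord_T L_5 = 2` all being
KERNEL theorems of the tree. Read next to g2's `C<label>.kolyvaginDepthSupply_clause` (same clause,
same curve, from the depth-table bit `c_1(ℓ) ≠ 0` modulo `hF`): the two doors agree at every row.
CONDITIONAL on the seven named facts, `hkato` and the symbol data; per-curve; BSD is not proved by it.
[cite: SteinWuthrich2013, Thm. 1.1 and §3] [cite: MazurTateTeitelbaum1986Invent, §I.10–I.13]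
[cite: BurungaleEtAl2026, Thm. 1 (arXiv:2312.09301 §0.1)] [cite: Kolyvagin1991MathAnn, §2 Thm. 4] -/
theorem kolyvaginDepthSupply_clause_of_lambda_five_of_mem_depthTable
    (hA : BurungaleEtAl2026_exists_kolyvaginClass_ne_zero)
    (hF : Kolyvagin1991_selmerCorank_of_kolyvaginClass_ne_zero)
    (hmod : exists_isNewformOf) (hHL : HoffsteinLuo1997_exists_twist_L_one_ne_zero)
    (hBFH : bumpFriedbergHoffstein_exists_heegnerField_split_twist_simpleZero)
    (hGZK : rank_eq_analyticRank_of_analyticRank_le_one) (hPRS : Schneider1985_order_charGenerator) :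
    ∀ (C : AtlasCurve) (hC : C ∈ ([c389a1, c433a1, c446d1, c563a1, c571b1, c643a1, c664a1, c681c1, c707a1, c709a1, c718b1,
      c794a1, c817a1, c916c1, c944e1, c997b1, c997c1] : List AtlasCurve)) (c : AtlasCell) (_ : c ∈ C.cells)
    [Fact c.p.Prime], c.p = 5 →
    haveI := AtlasCurve.isElliptic (AtlasCurve.check_of_all depthTable_atlas_ok (mem_depthTable_of_mem_five hC)).1;
    haveI := AtlasCurve.isGloballyMinimal (AtlasCurve.check_of_all depthTable_atlas_ok (mem_depthTable_of_mem_five hC)).2;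
    ∀ {N : ℕ} [NeZero N] {f : CuspForm (Gamma0 N) 2}, IsNewformOf (C.e.baseChange ℚ) f →
      (∀ (κ : ZpExtension ℚ c.p) (γ : Field.absoluteGaloisGroup ℚ),
        kato_divisibility (C.e.baseChange ℚ) c.p (κ := κ) (γ := γ) (f := f)) →
      ∀ (D : ℚ), ‖(D : ℚ_[c.p])‖ = 1 → (∀ x : ℚ, ‖(ratPlusSymbol f x : ℚ_[c.p])‖ ≤ 1) →
      (∀ u : ℕ, u < c.p ^ (c.n + 1) → ¬ c.p ∣ u →
        ratPlusSymbol f ((u : ℚ) / (c.p : ℚ) ^ (c.n + 1)) = (c.tabHi.getD u 0 : ℚ) / D ∧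
        ratPlusSymbol f ((u : ℚ) / (c.p : ℚ) ^ c.n) = (c.tabLo.getD (u % c.p ^ c.n) 0 : ℚ) / D) →
      ∃ (p : ℕ) (hp : Fact p.Prime), 5 ≤ p ∧ (C.e.baseChange ℚ).HasGoodReductionAtPrime p ∧ ¬ (p : ℤ) ∣
      (C.e.baseChange ℚ).frobeniusTrace p ∧ (C.e.baseChange ℚ).HasSurjectiveModNGaloisRep p ∧ ∃ (K : Type) (_ : Field K) (_ :
      NumberField K), Literature.NumberTheory.EllipticCurves.IsImaginaryQuadratic K ∧
      NumberField.discr K ≠ -3 ∧ NumberField.discr K ≠ -4 ∧ ¬ ((p : ℤ) ∣ NumberField.discr K) ∧ ¬ (p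
      ∣ (C.e.baseChange ℚ).conductorNorm ℤ) ∧ ∃ (_ : NeZero ((C.e.baseChange ℚ).conductorNorm ℤ)),
      Literature.NumberTheory.EllipticCurves.SatisfiesHeegnerHypothesis ((C.e.baseChange ℚ).conductorNorm ℤ) K ∧ ∃
      (Dt : Literature.NumberTheory.EllipticCurves.ModularForms.ModularParametrizationData (C.e.baseChange ℚ)
      ((C.e.baseChange ℚ).conductorNorm ℤ)) (β : ℤ) (ι : K →+* ℂ) (n : ℕ) (d :
      Literature.NumberTheory.EllipticCurves.KolyvaginHeegnerData Dt β ι n) (M : ℕ),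
      Literature.NumberTheory.EllipticCurves.KolyvaginDescent.KolSupp
      (Literature.NumberTheory.EllipticCurves.Zhang2014.IsKolyvaginPrime ((C.e.baseChange ℚ).conductorNorm ℤ) (C.e.baseChange ℚ) K p)
      n ∧ 1 ≤ M ∧ (M : ℕ∞) ≤ Literature.NumberTheory.EllipticCurves.Zhang2014.levelIndex (C.e.baseChange ℚ) p n ∧
      d.kolyvaginClass hp.out M ≠ 0 ∧ (∀ (n' : ℕ) (d' :
      Literature.NumberTheory.EllipticCurves.KolyvaginHeegnerData Dt β ι n') (M' : ℕ),
      Literature.NumberTheory.EllipticCurves.KolyvaginDescent.KolSupp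
      (Literature.NumberTheory.EllipticCurves.Zhang2014.IsKolyvaginPrime ((C.e.baseChange ℚ).conductorNorm ℤ) (C.e.baseChange ℚ) K p)
      n' → 1 ≤ M' → (M' : ℕ∞) ≤ Literature.NumberTheory.EllipticCurves.Zhang2014.levelIndex (C.e.baseChange ℚ) p n' →
      d'.kolyvaginClass hp.out M' ≠ 0 → n.primeFactors.card ≤ n'.primeFactors.card) ∧
      ((n.primeFactors.card + 1 = (C.e.baseChange ℚ).mordellWeilRank ∧ ((C.e.baseChange ℚ).quadraticTwist (NumberField.discr K :
      ℚ)).mordellWeilRank < (C.e.baseChange ℚ).mordellWeilRank) ∨ (n.primeFactors.card = (C.e.baseChange ℚ).mordellWeilRank ∧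
      ((C.e.baseChange ℚ).quadraticTwist (NumberField.discr K : ℚ)).mordellWeilRank = (C.e.baseChange ℚ).mordellWeilRank + 1)) := by
  intro C hC c hc _ hc5 N _ f hf hkato D hD hint htab
  have hC' : C ∈ ([c389a1, c433a1, c446d1, c563a1, c571b1, c643a1, c655a1, c664a1, c681c1, c707a1, c709a1,
      c718b1, c794a1, c817a1, c916c1, c944e1, c997b1, c997c1] : List AtlasCurve) := mem_depthTable_of_mem_five hC
  haveI := AtlasCurve.isElliptic (AtlasCurve.check_of_all depthTable_atlas_ok hC').1
  haveI := AtlasCurve.isGloballyMinimal (AtlasCurve.check_of_all depthTable_atlas_ok hC').2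
  have hsurj : (C.e.baseChange ℚ).HasSurjectiveModNGaloisRep c.p := by
    rw [hc5]; exact hasSurjectiveModNGaloisRep_five_of_mem_depthTable C hC
  exact kolyvaginDepthSupply_clause_of_atlasCell hA hF hmod hHL hBFH hGZK hPRS
    (AtlasCurve.check_of_all depthTable_atlas_ok hC').1 hc _ rfl hf hkato
    (two_le_rank_of_mem_depthTable C hC') D hD hint htab hsurj


/-- **AGREEMENT ROW `655a1`, λ-side, `p = 7`** (the 18th depth-table curve; `5 ∣ N = 655`, so its
atlas cells are at `p = 7, 11, 13` and g2's row is `(7, −51, 83)`). For the cell `c ∈ c655a1.cells` with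
`c.p = 7`: the newform `hf`, Kato 17.4 `hkato` and the symbol DATA give the clause of
`KolyvaginDepthSupply` at `W = c655a1.e ⊗ ℚ`, verbatim — `ρ̄_{E,7}` onto (`C655a1.hasSurjectiveModNGaloisRep_7`)
and `2 ≤ rank` kernel theorems. CONDITIONAL on the seven named facts, `hkato` and the symbol data;
per-curve; BSD is not proved by it. [cite: SteinWuthrich2013, Thm. 1.1 and §3]
[cite: BurungaleEtAl2026, Thm. 1 (arXiv:2312.09301 §0.1)] [cite: Kolyvagin1991MathAnn, §2 Thm. 4] -/
theorem kolyvaginDepthSupply_clause_of_lambda_seven_655a1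
    (hA : BurungaleEtAl2026_exists_kolyvaginClass_ne_zero)
    (hF : Kolyvagin1991_selmerCorank_of_kolyvaginClass_ne_zero)
    (hmod : exists_isNewformOf) (hHL : HoffsteinLuo1997_exists_twist_L_one_ne_zero)
    (hBFH : bumpFriedbergHoffstein_exists_heegnerField_split_twist_simpleZero)
    (hGZK : rank_eq_analyticRank_of_analyticRank_le_one) (hPRS : Schneider1985_order_charGenerator)
    {c : AtlasCell} (hc : c ∈ c655a1.cells) [Fact c.p.Prime] (hc7 : c.p = 7) :
    haveI := AtlasCurve.isElliptic (AtlasCurve.check_of_all atlasR2A00_check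
      (show c655a1 ∈ atlasR2A00 by simp [atlasR2A00])).1;
    haveI := AtlasCurve.isGloballyMinimal (AtlasCurve.check_of_all atlasR2A00_check
      (show c655a1 ∈ atlasR2A00 by simp [atlasR2A00])).2;
    ∀ {N : ℕ} [NeZero N] {f : CuspForm (Gamma0 N) 2}, IsNewformOf (c655a1.e.baseChange ℚ) f →
      (∀ (κ : ZpExtension ℚ c.p) (γ : Field.absoluteGaloisGroup ℚ),
        kato_divisibility (c655a1.e.baseChange ℚ) c.p (κ := κ) (γ := γ) (f := f)) →
      ∀ (D : ℚ), ‖(D : ℚ_[c.p])‖ = 1 → (∀ x : ℚ, ‖(ratPlusSymbol f x : ℚ_[c.p])‖ ≤ 1) →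
      (∀ u : ℕ, u < c.p ^ (c.n + 1) → ¬ c.p ∣ u →
        ratPlusSymbol f ((u : ℚ) / (c.p : ℚ) ^ (c.n + 1)) = (c.tabHi.getD u 0 : ℚ) / D ∧
        ratPlusSymbol f ((u : ℚ) / (c.p : ℚ) ^ c.n) = (c.tabLo.getD (u % c.p ^ c.n) 0 : ℚ) / D) →
      ∃ (p : ℕ) (hp : Fact p.Prime), 5 ≤ p ∧ (c655a1.e.baseChange ℚ).HasGoodReductionAtPrime p ∧ ¬ (p : ℤ) ∣
      (c655a1.e.baseChange ℚ).frobeniusTrace p ∧ (c655a1.e.baseChange ℚ).HasSurjectiveModNGaloisRep p ∧ ∃ (K : Type) (_ : Field K) (_ :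
      NumberField K), Literature.NumberTheory.EllipticCurves.IsImaginaryQuadratic K ∧
      NumberField.discr K ≠ -3 ∧ NumberField.discr K ≠ -4 ∧ ¬ ((p : ℤ) ∣ NumberField.discr K) ∧ ¬ (p
      ∣ (c655a1.e.baseChange ℚ).conductorNorm ℤ) ∧ ∃ (_ : NeZero ((c655a1.e.baseChange ℚ).conductorNorm ℤ)),
      Literature.NumberTheory.EllipticCurves.SatisfiesHeegnerHypothesis ((c655a1.e.baseChange ℚ).conductorNorm ℤ) K ∧ ∃
      (Dt : Literature.NumberTheory.EllipticCurves.ModularForms.ModularParametrizationData (c655a1.e.baseChange ℚ)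
      ((c655a1.e.baseChange ℚ).conductorNorm ℤ)) (β : ℤ) (ι : K →+* ℂ) (n : ℕ) (d :
      Literature.NumberTheory.EllipticCurves.KolyvaginHeegnerData Dt β ι n) (M : ℕ),
      Literature.NumberTheory.EllipticCurves.KolyvaginDescent.KolSupp
      (Literature.NumberTheory.EllipticCurves.Zhang2014.IsKolyvaginPrime ((c655a1.e.baseChange ℚ).conductorNorm ℤ) (c655a1.e.baseChange ℚ) K p)
      n ∧ 1 ≤ M ∧ (M : ℕ∞) ≤ Literature.NumberTheory.EllipticCurves.Zhang2014.levelIndex (c655a1.e.baseChange ℚ) p n ∧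
      d.kolyvaginClass hp.out M ≠ 0 ∧ (∀ (n' : ℕ) (d' :
      Literature.NumberTheory.EllipticCurves.KolyvaginHeegnerData Dt β ι n') (M' : ℕ),
      Literature.NumberTheory.EllipticCurves.KolyvaginDescent.KolSupp
      (Literature.NumberTheory.EllipticCurves.Zhang2014.IsKolyvaginPrime ((c655a1.e.baseChange ℚ).conductorNorm ℤ) (c655a1.e.baseChange ℚ) K p)
      n' → 1 ≤ M' → (M' : ℕ∞) ≤ Literature.NumberTheory.EllipticCurves.Zhang2014.levelIndex (c655a1.e.baseChange ℚ) p n' →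
      d'.kolyvaginClass hp.out M' ≠ 0 → n.primeFactors.card ≤ n'.primeFactors.card) ∧
      ((n.primeFactors.card + 1 = (c655a1.e.baseChange ℚ).mordellWeilRank ∧ ((c655a1.e.baseChange ℚ).quadraticTwist (NumberField.discr K :
      ℚ)).mordellWeilRank < (c655a1.e.baseChange ℚ).mordellWeilRank) ∨ (n.primeFactors.card = (c655a1.e.baseChange ℚ).mordellWeilRank ∧
      ((c655a1.e.baseChange ℚ).quadraticTwist (NumberField.discr K : ℚ)).mordellWeilRank = (c655a1.e.baseChange ℚ).mordellWeilRank + 1)) := by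
  have hC : c655a1.check = true :=
    (AtlasCurve.check_of_all atlasR2A00_check (show c655a1 ∈ atlasR2A00 by simp [atlasR2A00])).1
  haveI := AtlasCurve.isElliptic hC
  haveI := AtlasCurve.isGloballyMinimal
    (AtlasCurve.check_of_all atlasR2A00_check (show c655a1 ∈ atlasR2A00 by simp [atlasR2A00])).2
  intro N _ f hf hkato D hD hint htab
  have hsurj : (c655a1.e.baseChange ℚ).HasSurjectiveModNGaloisRep c.p := by
    rw [hc7]; exact hasSurjectiveModNGaloisRep_seven_655a1
  exact kolyvaginDepthSupply_clause_of_atlasCell hA hF hmod hHL hBFH hGZK hPRS hC hc _ rfl hf hkato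
    KernelCerts001.C655a1.row D hD hint htab hsurj

/-! ## §4 Showcase `389a1` in the wording of g2's `C389a1.kolyvaginDepthSupply_clause` (`W = Curve389a1.E`) -/

namespace C389a1

/-- `389a1`'s integer model in the atlas is the tree's `Curve389a1.E` after base change
(`Rank2ObservatoryPadicRowCells.baseChange_e389_eq`; `c389a1.e` and `e389` are the same literal
`[0, 1, 1, −2, 0]`). [cite: CremonaAlgorithms1997, Table 1 (389a1)] -/
theorem curve_eq_atlas : Curve389a1.E = c389a1.e.baseChange ℚ :=
  Cell389a1.baseChange_e389_eq.symm

/-- **AGREEMENT ROW `389a1`, λ-side (`p = 5`): the crux's clause at `389a1` with NO derived-class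
computation.** For the cell `c ∈ c389a1.cells` with `c.p = 5` (`a_5 = −3`, level `n = 1`, table of
`2·[u/25]⁺`; `Rank2ObservatoryPadicAtlasR2A00`), GIVEN the seven named facts (`hA hF hmod hHL hBFH hGZK
hPRS`), the newform `hf`, Kato 17.4 `hkato`, and the symbol DATA (`D, hD, hint, htab`), the clause of
`KolyvaginDepthSupply` holds at `Curve389a1.E` — `ρ̄_{E,5}` onto (`C389a1.hasSurjectiveModNGaloisRep_5`)
and `2 ≤ rank_ℤ E(ℚ)` (`Curve389a1.two_le_mordellWeilRank_row`) being kernel theorems of the tree.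
Read next to `C389a1.kolyvaginDepthSupply_clause` (the same clause from the depth-table bit
`c_1(19) ≠ 0` modulo `hF` alone): the two doors AGREE at `389a1` on disjoint trust bases. Per-curve;
BSD is not proved by it. [cite: SteinWuthrich2013, Thm. 1.1 and §3]
[cite: BurungaleEtAl2026, Thm. 1 (arXiv:2312.09301 §0.1)] [cite: Kolyvagin1991MathAnn, §2 Thm. 4]
[cite: CremonaAlgorithms1997, Table 1 (389a1)] -/
theorem kolyvaginDepthSupply_clause_of_lambda
    (hA : BurungaleEtAl2026_exists_kolyvaginClass_ne_zero)
    (hF : Kolyvagin1991_selmerCorank_of_kolyvaginClass_ne_zero)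
    (hmod : exists_isNewformOf) (hHL : HoffsteinLuo1997_exists_twist_L_one_ne_zero)
    (hBFH : bumpFriedbergHoffstein_exists_heegnerField_split_twist_simpleZero)
    (hGZK : rank_eq_analyticRank_of_analyticRank_le_one) (hPRS : Schneider1985_order_charGenerator)
    {c : AtlasCell} (hc : c ∈ c389a1.cells) (hc5 : c.p = 5) :
    haveI := curve389a1_isGloballyMinimal;
    ∀ {N : ℕ} [NeZero N] {f : CuspForm (Gamma0 N) 2} (_hf : IsNewformOf Curve389a1.E f)
    (_hkato : ∀ (κ : ZpExtension ℚ 5) (γ : Field.absoluteGaloisGroup ℚ),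
      kato_divisibility Curve389a1.E 5 (κ := κ) (γ := γ) (f := f))
    (D : ℚ) (_hD : ‖(D : ℚ_[5])‖ = 1) (_hint : ∀ x : ℚ, ‖(ratPlusSymbol f x : ℚ_[5])‖ ≤ 1)
    (_htab : ∀ u : ℕ, u < 5 ^ (c.n + 1) → ¬ 5 ∣ u →
      ratPlusSymbol f ((u : ℚ) / (5 : ℚ) ^ (c.n + 1)) = (c.tabHi.getD u 0 : ℚ) / D ∧
      ratPlusSymbol f ((u : ℚ) / (5 : ℚ) ^ c.n) = (c.tabLo.getD (u % 5 ^ c.n) 0 : ℚ) / D),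
    ∃ (p : ℕ) (hp : Fact p.Prime), 5 ≤ p ∧ Curve389a1.E.HasGoodReductionAtPrime p ∧ ¬ (p : ℤ) ∣
      Curve389a1.E.frobeniusTrace p ∧ Curve389a1.E.HasSurjectiveModNGaloisRep p ∧ ∃ (K : Type) (_ : Field K) (_ :
      NumberField K), Literature.NumberTheory.EllipticCurves.IsImaginaryQuadratic K ∧
      NumberField.discr K ≠ -3 ∧ NumberField.discr K ≠ -4 ∧ ¬ ((p : ℤ) ∣ NumberField.discr K) ∧ ¬ (p
      ∣ Curve389a1.E.conductorNorm ℤ) ∧ ∃ (_ : NeZero (Curve389a1.E.conductorNorm ℤ)),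
      Literature.NumberTheory.EllipticCurves.SatisfiesHeegnerHypothesis (Curve389a1.E.conductorNorm ℤ) K ∧ ∃
      (Dt : Literature.NumberTheory.EllipticCurves.ModularForms.ModularParametrizationData Curve389a1.E
      (Curve389a1.E.conductorNorm ℤ)) (β : ℤ) (ι : K →+* ℂ) (n : ℕ) (d :
      Literature.NumberTheory.EllipticCurves.KolyvaginHeegnerData Dt β ι n) (M : ℕ),
      Literature.NumberTheory.EllipticCurves.KolyvaginDescent.KolSupp
      (Literature.NumberTheory.EllipticCurves.Zhang2014.IsKolyvaginPrime (Curve389a1.E.conductorNorm ℤ) Curve389a1.E K p)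
      n ∧ 1 ≤ M ∧ (M : ℕ∞) ≤ Literature.NumberTheory.EllipticCurves.Zhang2014.levelIndex Curve389a1.E p n ∧
      d.kolyvaginClass hp.out M ≠ 0 ∧ (∀ (n' : ℕ) (d' :
      Literature.NumberTheory.EllipticCurves.KolyvaginHeegnerData Dt β ι n') (M' : ℕ),
      Literature.NumberTheory.EllipticCurves.KolyvaginDescent.KolSupp
      (Literature.NumberTheory.EllipticCurves.Zhang2014.IsKolyvaginPrime (Curve389a1.E.conductorNorm ℤ) Curve389a1.E K p)
      n' → 1 ≤ M' → (M' : ℕ∞) ≤ Literature.NumberTheory.EllipticCurves.Zhang2014.levelIndex Curve389a1.E p n' →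
      d'.kolyvaginClass hp.out M' ≠ 0 → n.primeFactors.card ≤ n'.primeFactors.card) ∧
      ((n.primeFactors.card + 1 = Curve389a1.E.mordellWeilRank ∧ (Curve389a1.E.quadraticTwist (NumberField.discr K :
      ℚ)).mordellWeilRank < Curve389a1.E.mordellWeilRank) ∨ (n.primeFactors.card = Curve389a1.E.mordellWeilRank ∧
      (Curve389a1.E.quadraticTwist (NumberField.discr K : ℚ)).mordellWeilRank = Curve389a1.E.mordellWeilRank + 1)) := by
  haveI := curve389a1_isGloballyMinimal
  intro N _ f hf hkato D hD hint htab
  have hC : c389a1.check = true :=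
    (AtlasCurve.check_of_all atlasR2A00_check (by simp [atlasR2A00])).1
  -- free the cell's prime so that `c.p = 5` can be substituted
  obtain ⟨p', ap, n, A, tHi, tLo, H, L⟩ := c
  dsimp only at hc5
  subst hc5
  exact kolyvaginDepthSupply_clause_of_atlasCell hA hF hmod hHL hBFH hGZK hPRS hC hc
    (hp := ⟨by norm_num⟩) Curve389a1.E curve_eq_atlas hf hkato Curve389a1.two_le_mordellWeilRank_row
    D hD hint htab hasSurjectiveModNGaloisRep_5

end C389a1

end Summit.BirchSwinnertonDyer.BirchSwinnertonDyer.Theorems.KolyvaginDepthDoor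

end
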